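import Mathlib
import Literature.Analysis.FluidPDE.Tao2016AveragedNS.RenormalisedCascadeWaves
import Summits.NavierStokesRegularity.NavierStokesRegularity.Theses.TaoLadderRungTwoBreak

/-!
# Crux `TaoLadderRungTwoBreak.NoSurvivingEternalViscBddOne` (stmt-NavierStokesRegularity-20419), stub (ρ0), DYADIC MEMBER:
# the KOLMOGOROV EQUILIBRIUM of the critical chain is EXACT AT EVERY BASE, and it is the ONLY positive equilibrium with bounded
# shell ratios (the equilibrium recursion is forward-unstable with multiplier −2)

MODEL lattice ODEs only (the positive Katz–Pavlović / Desnianskii–Novikov chain in Tao's critical variables,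
`V̇_n = Λ V_{n-1}² − Λ⁻¹ V_n V_{n+1}`, `Λ = (1+ε₀)^{5/2}`, tree `…WakeDyadicClassical`); nothing in this file is a statement about the
Navier–Stokes equations, and no stub, crux, rung or summit is proved by it (`--supports stmt-NavierStokesRegularity-20419`).

WHY (numerics of this hand, evidence `NUMERICS-20419-dyadic-front-families-leafhand4-g6.md` F6 on ⟨20419⟩/⟨20205⟩/⟨20420⟩): as the base
tends to one the terminal wake of the dyadic blow-up front LOCKS onto the Kolmogorov law `v_n ≍ Λ^{2n/3}` (|(1−s) − 2/3| ≤ 4e-5 for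
ε₀ ≤ 0.011, corrections ≲ e^{−0.1/ε₀}) — exponent `s = 1/3`, 40 % above the (S₁) threshold `s = 1/5` of `dyadic_noSurviving_of_terminalRegularity`.
This file records the exact lattice facts behind that target:
* `kolmogorov_balance` — for every `Λ > 0`, `c`, `x`: `Λ (cΛ^{(2/3)(x−1)})² = Λ⁻¹ (cΛ^{(2/3)x})(cΛ^{(2/3)(x+1)})`: pump and drain balance
  EXACTLY on the Kolmogorov profile, at every base (no small-ε₀ approximation);
* `kolmogorov_equilibrium_hasDerivAt` — hence `V_n(t) = c Λ^{2n/3}` is an exact (time-independent) solution of the critical chain;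
* `equilibrium_ratio_recursion` / `equilibrium_logRatio_recursion` — every positive equilibrium has shell ratios `r_n = V_n/V_{n−1}` with
  `r_{n+1} r_n² = Λ²`, i.e. `y_{n+1} = −2 y_n` for `y_n = log r_n − (2/3) log Λ`: the deviation from Kolmogorov DOUBLES (with alternating
  sign) at every shell;
* `equilibrium_eq_kolmogorov_of_bounded_logRatio` — RIGIDITY: a positive equilibrium whose log-ratios stay within a bounded distance of
  `(2/3) log Λ` IS the Kolmogorov profile `V_n = V_0 Λ^{2n/3}` (a non-zero deviation would grow like `2^n`).
HONEST LABEL: exact algebra of the model chain (the quasi-static wake's only admissible equilibrium); the dynamical statement W1-dyadic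
(terminal exponent `s > 1/5` for every bounded positive ancient solution at small base), (ρ0), ⟨20419⟩ and every NS statement remain OPEN;
rung 0.
-/

-- the summit and its single sub-problem share the name (CONVENTIONS §1)
set_option linter.dupNamespace false

namespace Summit.NavierStokesRegularity.NavierStokesRegularity.Theorems.NoSurvivingEternalViscBddOne.KolmogorovEquilibrium

open Real

/-! ## Exact balance on the Kolmogorov profile -/

/-- Pump side of the balance: `Λ · (Λ^{(2/3)(x−1)})² = Λ^{(4x−1)/3}`. [folklore] -/
theorem pump_weight {Λ : ℝ} (hΛ : 0 < Λ) (x : ℝ) :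
    Λ * (Λ ^ ((2 : ℝ) / 3 * (x - 1))) ^ 2 = Λ ^ ((4 * x - 1) / 3) := by
  have h2 : (Λ ^ ((2 : ℝ) / 3 * (x - 1))) ^ 2 = Λ ^ ((2 : ℝ) / 3 * (x - 1) * 2) := by
    rw [← Real.rpow_natCast (Λ ^ ((2 : ℝ) / 3 * (x - 1))) 2, ← Real.rpow_mul hΛ.le]
    norm_num
  rw [h2]
  conv_lhs => rw [← Real.rpow_one Λ]
  rw [← Real.rpow_mul hΛ.le, ← Real.rpow_add hΛ]
  congr 1
  ring

/-- Drain side of the balance: `Λ⁻¹ · Λ^{(2/3)x} · Λ^{(2/3)(x+1)} = Λ^{(4x−1)/3}`. [folklore] -/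
theorem drain_weight {Λ : ℝ} (hΛ : 0 < Λ) (x : ℝ) :
    Λ⁻¹ * (Λ ^ ((2 : ℝ) / 3 * x) * Λ ^ ((2 : ℝ) / 3 * (x + 1))) = Λ ^ ((4 * x - 1) / 3) := by
  rw [← Real.rpow_neg_one Λ, ← Real.rpow_add hΛ, ← Real.rpow_add hΛ]
  congr 1
  ring

/-- **Kolmogorov balance, exact at every base.**  For every `Λ > 0`, amplitude `c` and (real) shell index `x`,
`Λ (c Λ^{(2/3)(x−1)})² − Λ⁻¹ (c Λ^{(2/3)x}) (c Λ^{(2/3)(x+1)}) = 0`: on the profile `V_n = c Λ^{2n/3}` the pump from the shell below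
and the drain to the shell above cancel identically.
(The object is the Kolmogorov fixed point of the dyadic model of Cheskidov–Friedlander–Pavlović, arXiv:math/0610815, there at base `2^{5/2}`.)
[cite: Tao2016AveragedNS, §1.2 and §4 (4.1) (the scalar cascade `λ^n X_{n+1} X_n²`); elementary] -/
theorem kolmogorov_balance {Λ : ℝ} (hΛ : 0 < Λ) (c x : ℝ) :
    Λ * (c * Λ ^ ((2 : ℝ) / 3 * (x - 1))) ^ 2
      - Λ⁻¹ * ((c * Λ ^ ((2 : ℝ) / 3 * x)) * (c * Λ ^ ((2 : ℝ) / 3 * (x + 1)))) = 0 := by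
  have h : Λ * (c * Λ ^ ((2 : ℝ) / 3 * (x - 1))) ^ 2
      - Λ⁻¹ * ((c * Λ ^ ((2 : ℝ) / 3 * x)) * (c * Λ ^ ((2 : ℝ) / 3 * (x + 1))))
      = c ^ 2 * (Λ * (Λ ^ ((2 : ℝ) / 3 * (x - 1))) ^ 2)
        - c ^ 2 * (Λ⁻¹ * (Λ ^ ((2 : ℝ) / 3 * x) * Λ ^ ((2 : ℝ) / 3 * (x + 1)))) := by ring
  rw [h, pump_weight hΛ, drain_weight hΛ, sub_self]

/-- **The Kolmogorov profile is an exact equilibrium of the critical chain** (every base, every amplitude): the time-independent family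
`V_n(t) = c Λ^{2n/3}` satisfies `V̇_n = Λ V_{n-1}² − Λ⁻¹ V_n V_{n+1}` at every shell `n ∈ ℤ` and every time.
[cite: Tao2016AveragedNS, §4 (4.1); elementary] -/
theorem kolmogorov_equilibrium_hasDerivAt {Λ : ℝ} (hΛ : 0 < Λ) (c : ℝ) (n : ℤ) (t : ℝ) :
    HasDerivAt (fun _ : ℝ => c * Λ ^ ((2 : ℝ) / 3 * (n : ℝ)))
      (Λ * (c * Λ ^ ((2 : ℝ) / 3 * ((n - 1 : ℤ) : ℝ))) ^ 2
        - Λ⁻¹ * ((c * Λ ^ ((2 : ℝ) / 3 * (n : ℝ))) * (c * Λ ^ ((2 : ℝ) / 3 * ((n + 1 : ℤ) : ℝ))))) t := by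
  have hbal := kolmogorov_balance hΛ c (n : ℝ)
  push_cast
  rw [hbal]
  exact hasDerivAt_const t _

/-! ## Every positive equilibrium: the ratio recursion and its instability -/

/-- **Ratio recursion of a positive equilibrium.**  If `V_n > 0` and `Λ V_{n-1}² = Λ⁻¹ V_n V_{n+1}` for `n ≥ 1`, then the shell ratios
`r_n = V_n / V_{n-1}` obey `r_{n+1} · r_n² = Λ²` (`n ≥ 1`).  [elementary] -/
theorem equilibrium_ratio_recursion {Λ : ℝ} (hΛ : 0 < Λ) {V : ℕ → ℝ} (hpos : ∀ n, 0 < V n)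
    (heq : ∀ n, 1 ≤ n → Λ * V (n - 1) ^ 2 = Λ⁻¹ * (V n * V (n + 1))) (n : ℕ) (hn : 1 ≤ n) :
    (V (n + 1) / V n) * (V n / V (n - 1)) ^ 2 = Λ ^ 2 := by
  have h := heq n hn
  have hVn := hpos n
  have hVm := hpos (n - 1)
  have hkey : V n * V (n + 1) = Λ ^ 2 * V (n - 1) ^ 2 := by
    calc V n * V (n + 1) = Λ * (Λ⁻¹ * (V n * V (n + 1))) := by
            rw [← mul_assoc, mul_inv_cancel₀ hΛ.ne', one_mul]
      _ = Λ * (Λ * V (n - 1) ^ 2) := by rw [← h]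
      _ = Λ ^ 2 * V (n - 1) ^ 2 := by ring
  field_simp
  nlinarith [hkey]

/-- **Log-ratio recursion (multiplier −2).**  With `y_n = log (V_n/V_{n-1}) − (2/3) log Λ`, a positive equilibrium has `y_{n+1} = −2 y_n`
(`n ≥ 1`): the deviation from the Kolmogorov ratio `Λ^{2/3}` doubles at each shell with alternating sign.  [elementary] -/
theorem equilibrium_logRatio_recursion {Λ : ℝ} (hΛ : 0 < Λ) {V : ℕ → ℝ} (hpos : ∀ n, 0 < V n)
    (heq : ∀ n, 1 ≤ n → Λ * V (n - 1) ^ 2 = Λ⁻¹ * (V n * V (n + 1))) (n : ℕ) (hn : 1 ≤ n) :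
    Real.log (V (n + 1) / V n) - 2 / 3 * Real.log Λ
      = -2 * (Real.log (V n / V (n - 1)) - 2 / 3 * Real.log Λ) := by
  have hr := equilibrium_ratio_recursion hΛ hpos heq n hn
  have h1 : 0 < V (n + 1) / V n := div_pos (hpos _) (hpos _)
  have h2 : 0 < V n / V (n - 1) := div_pos (hpos _) (hpos _)
  have hlog := congrArg Real.log hr
  rw [Real.log_mul h1.ne' (pow_pos h2 2).ne', Real.log_pow, Real.log_pow] at hlog
  push_cast at hlog
  linarith

/-- Iterating the multiplier: `y_{1+k} = (−2)^k y_1`.  [elementary] -/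
theorem equilibrium_logRatio_iterate {Λ : ℝ} (hΛ : 0 < Λ) {V : ℕ → ℝ} (hpos : ∀ n, 0 < V n)
    (heq : ∀ n, 1 ≤ n → Λ * V (n - 1) ^ 2 = Λ⁻¹ * (V n * V (n + 1))) (k : ℕ) :
    Real.log (V (1 + k + 1) / V (1 + k)) - 2 / 3 * Real.log Λ
      = (-2) ^ (k + 1) * (Real.log (V 1 / V 0) - 2 / 3 * Real.log Λ) := by
  induction k with
  | zero =>
    simpa using equilibrium_logRatio_recursion hΛ hpos heq 1 le_rfl
  | succ k ih =>
    have h := equilibrium_logRatio_recursion hΛ hpos heq (1 + k + 1) (by omega)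
    have e1 : 1 + (k + 1) + 1 = 1 + k + 1 + 1 := by ring
    have e2 : 1 + (k + 1) = 1 + k + 1 := by ring
    rw [e1, e2, h, show 1 + k + 1 - 1 = 1 + k by omega, ih]
    ring

/-- **RIGIDITY: bounded log-ratios force the Kolmogorov profile.**  A positive equilibrium of the critical chain whose log shell ratios
stay within a bounded distance of `(2/3) log Λ` has EXACTLY the Kolmogorov ratios: `V_{n+1}/V_n = Λ^{2/3}` for every `n` (a non-zero
deviation would grow like `2^n`).  In particular the quasi-static wake of a type-I front can only equilibrate on the `s = 1/3` law.
(Compare the uniqueness of the Kolmogorov fixed point in Cheskidov–Friedlander–Pavlović, arXiv:math/0610815, base `2^{5/2}`.)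
[cite: Tao2016AveragedNS, §4 (4.1); elementary] -/
theorem equilibrium_eq_kolmogorov_of_bounded_logRatio {Λ : ℝ} (hΛ : 0 < Λ) {V : ℕ → ℝ} (hpos : ∀ n, 0 < V n)
    (heq : ∀ n, 1 ≤ n → Λ * V (n - 1) ^ 2 = Λ⁻¹ * (V n * V (n + 1)))
    (hbdd : ∃ B : ℝ, ∀ n, |Real.log (V (n + 1) / V n) - 2 / 3 * Real.log Λ| ≤ B) (n : ℕ) :
    V (n + 1) / V n = Λ ^ ((2 : ℝ) / 3) := by
  obtain ⟨B, hB⟩ := hbdd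
  -- the first deviation vanishes: |(-2)^{k+1} y_1| ≤ B for all k forces y_1 = 0
  set y1 := Real.log (V 1 / V 0) - 2 / 3 * Real.log Λ with hy1
  have hy1zero : y1 = 0 := by
    by_contra hne
    have hpos1 : 0 < |y1| := abs_pos.2 hne
    -- choose k with 2^(k+1) |y1| > B
    obtain ⟨k, hk⟩ := pow_unbounded_of_one_lt (B / |y1|) (by norm_num : (1 : ℝ) < 2)
    have hiter := equilibrium_logRatio_iterate hΛ hpos heq k
    have hbound := hB (1 + k)
    rw [hiter, abs_mul, abs_pow, abs_neg, abs_two] at hbound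
    have : (2 : ℝ) ^ (k + 1) * |y1| ≤ B := hbound
    have h2 : (2 : ℝ) ^ k * |y1| < 2 ^ (k + 1) * |y1| := by
      rw [pow_succ]; nlinarith [pow_pos (by norm_num : (0:ℝ) < 2) k]
    have h3 : B < 2 ^ k * |y1| := by rwa [div_lt_iff₀ hpos1] at hk
    linarith
  -- hence every deviation vanishes
  have hdev : Real.log (V (n + 1) / V n) - 2 / 3 * Real.log Λ = 0 := by
    rcases n with _ | m
    · simpa [hy1] using hy1zero
    · have hiter := equilibrium_logRatio_iterate hΛ hpos heq m
      rw [show 1 + m + 1 = m + 1 + 1 by ring, show 1 + m = m + 1 by ring] at hiter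
      rw [hiter, ← hy1, hy1zero, mul_zero]
  have hratio_pos : 0 < V (n + 1) / V n := div_pos (hpos _) (hpos _)
  have hlog : Real.log (V (n + 1) / V n) = Real.log (Λ ^ ((2 : ℝ) / 3)) := by
    rw [Real.log_rpow hΛ]; linarith
  exact Real.log_injOn_pos (Set.mem_Ioi.2 hratio_pos) (Set.mem_Ioi.2 (Real.rpow_pos_of_pos hΛ _)) hlog

end Summit.NavierStokesRegularity.NavierStokesRegularity.Theorems.NoSurvivingEternalViscBddOne.KolmogorovEquilibrium
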